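import Summits.PneNP.PneNP.Theorems.RamseyUncertifiableRegularResolutionRungPathProcess

/-!
# Route RamseyUncertifiable, crux `RegularResolutionRung` (stmt-PneNP-9818), line `sound-path-bottleneck`:
# the path process `D*` — soundly orderable sets and the structural invariants of the run

Auxiliary file 4 for the registered stub `stub_soundPathCount` (ABdRLNR arXiv:2012.09476 §6 under `D*`).

* `soundlyOrderable_insert`, `SoundlyOrderable.anti`, `le_card_commonNbhd_of_soundlyOrderable`: the
  accepted set of the walk is soundly orderable by construction (rule F2), soundness is hereditary, and a
  soundly orderable `Q` with `|Q| ≤ L₀` has `≥ δ^{|Q|}·m` common neighbours (`commonNbhd_chain_lb`);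
* `Ctx.run_struct`: after `n` steps the current index is a line of `π`; the visited nodes followed by the
  current one form a DAG path from the start node; the event nodes are, in order, among the visited nodes;
  every visited resolution node has its event; every event sits at a resolution line on its variable and
  records the answer computed from the earlier events; the coins read by `mrun` are exactly the coin
  events; and the walk has reached an initial line or descended `n` lines (Claim 6.5's bookkeeping).

No propositions are defined; the registered sub-goal `spc_struct_anchor` credits the file. [folklore]
-/

set_option linter.dupNamespace false -- `Summit.PneNP.PneNP.…`: single-conjunct summit

noncomputable section

open scoped BigOperators

namespace Summit.PneNP.PneNP.Cruxes.RegularResolutionRung.SoundPathBottleneck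

open Finset
open Literature.Computability.MetaComplexity Literature.Computability.Complexity
open Summit.PneNP.PneNP.Theorems.RegularResolutionRung.Negative (cliqueCNF)

/-! ## Soundly orderable sets -/

section Sound

variable {m : ℕ} (H : SimpleGraph (Fin m)) [DecidableRel H.Adj] (δ : ℝ) (L₀ : ℕ)

/-- The empty set is soundly orderable. -/
theorem soundlyOrderable_empty : SoundlyOrderable H δ L₀ ∅ :=
  ⟨[], List.nodup_nil, rfl, fun j hj => by simp at hj⟩

variable {H δ L₀}

/-- Adding a vertex that passes the dense-extension test against every `≤ L₀`-subset of `Q`. -/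
theorem soundlyOrderable_insert {Q : Finset (Fin m)} (hQ : SoundlyOrderable H δ L₀ Q) {v : Fin m}
    (hv : v ∉ Q) (hcond : ∀ U ⊆ Q, U.card ≤ L₀ →
      δ * ((commonNbhd H U).card : ℝ) ≤ ((commonNbhd H (insert v U)).card : ℝ)) :
    SoundlyOrderable H δ L₀ (insert v Q) := by
  obtain ⟨l, hnd, hl, hchain⟩ := hQ
  have hvl : v ∉ l := fun h => hv (hl ▸ List.mem_toFinset.2 h)
  have hlen : (l ++ [v]).length = l.length + 1 := by simp
  refine ⟨l ++ [v], ?_, ?_, ?_⟩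
  · exact List.nodup_append.2 ⟨hnd, List.nodup_singleton v, fun a ha b hb hab => hvl (by
      rw [List.mem_singleton] at hb; rw [← hb, ← hab]; exact ha)⟩
  · rw [List.toFinset_append, hl]; ext x; simp [Finset.mem_insert]
  · intro j hj U hU hUc
    by_cases hjl : j < l.length
    · have htake : (l ++ [v]).take j = l.take j := List.take_append_of_le_length hjl.le
      have hget : (l ++ [v]).get ⟨j, hj⟩ = l.get ⟨j, hjl⟩ := by
        simp [List.getElem_append_left hjl]
      rw [htake] at hU; rw [hget]
      exact hchain j hjl U hU hUc
    · have hj' : j = l.length := by rw [hlen] at hj; omega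
      subst hj'
      have htake : (l ++ [v]).take l.length = l := by simp
      have hget : (l ++ [v]).get ⟨l.length, hj⟩ = v := by simp
      rw [htake, hl] at hU; rw [hget]
      exact hcond U hU hUc

/-- Soundness is HEREDITARY: subsets of soundly orderable sets are soundly orderable (restrict the
witnessing order). -/
theorem SoundlyOrderable.anti {Q Q' : Finset (Fin m)} (hQ : SoundlyOrderable H δ L₀ Q) (hsub : Q' ⊆ Q) :
    SoundlyOrderable H δ L₀ Q' := by
  obtain ⟨l, hnd, hl, hchain⟩ := hQ
  subst hl
  -- induction on the witnessing list, from the right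
  induction l using List.reverseRecOn generalizing Q' with
  | nil =>
    have : Q' = ∅ := Finset.subset_empty.1 (by simpa using hsub)
    subst this; exact soundlyOrderable_empty H δ L₀
  | append_singleton l x ih =>
    have hlen : (l ++ [x]).length = l.length + 1 := by simp
    have hnd' : l.Nodup := (List.nodup_append.1 hnd).1
    have hxl : x ∉ l := fun h => (List.nodup_append.1 hnd).2.2 x h x (List.mem_singleton_self _) rfl
    -- the chain condition restricted to `l`, and the test passed by `x`
    have hchain' : ∀ (j : ℕ) (hj : j < l.length), ∀ U ⊆ (l.take j).toFinset, U.card ≤ L₀ →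
        δ * ((commonNbhd H U).card : ℝ) ≤ ((commonNbhd H (insert (l.get ⟨j, hj⟩) U)).card : ℝ) := by
      intro j hj U hU hUc
      have hj' : j < (l ++ [x]).length := by rw [hlen]; omega
      have h := hchain j hj' U (by rwa [List.take_append_of_le_length hj.le]) hUc
      have hget : (l ++ [x]).get ⟨j, hj'⟩ = l.get ⟨j, hj⟩ := by simp [List.getElem_append_left hj]
      rwa [hget] at h
    have hx : ∀ U ⊆ l.toFinset, U.card ≤ L₀ →
        δ * ((commonNbhd H U).card : ℝ) ≤ ((commonNbhd H (insert x U)).card : ℝ) := by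
      intro U hU hUc
      have h := hchain l.length (by rw [hlen]; omega) U (by simpa using hU) hUc
      have hget : (l ++ [x]).get ⟨l.length, by rw [hlen]; omega⟩ = x := by simp
      rwa [hget] at h
    have hQl : (l ++ [x]).toFinset = insert x l.toFinset := by ext v; simp
    rw [hQl] at hsub
    by_cases hxQ : x ∈ Q'
    · have hsub' : Q'.erase x ⊆ l.toFinset := fun v hv => by
        have := hsub (Finset.mem_of_mem_erase hv)
        rw [Finset.mem_insert] at this
        exact this.resolve_left (Finset.ne_of_mem_erase hv)
      have h := soundlyOrderable_insert (ih hnd' hchain' hsub') (Finset.notMem_erase x Q')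
        (fun U hU hUc => hx U (hU.trans hsub') hUc)
      rwa [Finset.insert_erase hxQ] at h
    · exact ih hnd' hchain' (fun v hv => by
        have := hsub hv
        rw [Finset.mem_insert] at this
        exact this.resolve_left (fun h => hxQ (h ▸ hv)))

/-- A soundly orderable `Q` with `|Q| ≤ L₀` has at least `δ^{|Q|}·m` common neighbours
(`commonNbhd_chain_lb` along the witnessing order). -/
theorem le_card_commonNbhd_of_soundlyOrderable (hδ : 0 ≤ δ) {Q : Finset (Fin m)}
    (hQ : SoundlyOrderable H δ L₀ Q) (hcard : Q.card ≤ L₀) :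
    δ ^ Q.card * (m : ℝ) ≤ ((commonNbhd H Q).card : ℝ) := by
  obtain ⟨l, hnd, hl, hchain⟩ := hQ
  subst hl
  rw [List.toFinset_card_of_nodup hnd] at hcard ⊢
  refine commonNbhd_chain_lb H hδ l fun j hj => hchain j hj _ subset_rfl ?_
  calc ((l.take j).toFinset).card ≤ (l.take j).length := List.toFinset_card_le _
    _ ≤ j := by rw [List.length_take]; exact min_le_left _ _
    _ ≤ L₀ := by omega

end Sound

/-! ## Structural invariants of the run -/

section Struct

variable {m : ℕ} {X : Ctx m}

/-- The start node is a line of the refutation … -/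
theorem Ctx.a₀_lt (hπ : IsResRefutation X.cnf X.π) : X.a₀ < X.π.length :=
  List.findIdx_lt_length_of_exists (by obtain ⟨l, hl, h⟩ := hπ.2; exact ⟨l, hl, by simp [h]⟩)

/-- … carrying the empty clause. -/
theorem Ctx.clause_a₀ (hπ : IsResRefutation X.cnf X.π) : (X.π[X.a₀]'(Ctx.a₀_lt hπ)).clause = ∅ := by
  have := List.findIdx_getElem (p := fun l : ResLine ℕ => decide (l.clause = ∅)) (w := Ctx.a₀_lt hπ)
  unfold Ctx.a₀
  simpa using this

/-- ONE STEP preserves the structural invariants (see `Ctx.run_struct`). -/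
theorem Ctx.struct_step (hπ : IsResRefutation X.cnf X.π) (c : Fin X.k × Fin m → Bool) (s : PState)
    (n : ℕ) (R : List (Fin X.k × Fin m))
    (h1 : s.cur < X.π.length)
    (h2 : IsDagPath (X.π.map ResLine.premises) (s.vis ++ [s.cur]))
    (h3 : (s.vis ++ [s.cur]).head? = some X.a₀)
    (h4 : (s.hist.map Ev.node).Sublist s.vis)
    (h6 : ∀ a ∈ s.vis, ∀ (ha : a < X.π.length) (i j x : ℕ), (X.π[a]).rule = .resolve i j x →
      ∃ e ∈ s.hist, e.node = a ∧ e.var = x)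
    (h7 : ∀ e ∈ s.hist, ∃ (he : e.node < X.π.length) (i j : ℕ), (X.π[e.node]).rule = .resolve i j e.var ∧
      (e.ans, e.coin) = X.answer c e.node e.var (s.hist.filter fun e' => e.node < e'.node))
    (h10 : R = s.hist.filterMap X.coinOf)
    (h11 : (X.π[s.cur]).rule = .initial ∨ s.cur + n ≤ X.a₀) :
    let s' := mstep X.query X.next c s
    ∃ h1' : s'.cur < X.π.length,
    IsDagPath (X.π.map ResLine.premises) (s'.vis ++ [s'.cur]) ∧
    (s'.vis ++ [s'.cur]).head? = some X.a₀ ∧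
    (s'.hist.map Ev.node).Sublist s'.vis ∧
    (∀ a ∈ s'.vis, ∀ (ha : a < X.π.length) (i j x : ℕ), (X.π[a]).rule = .resolve i j x →
      ∃ e ∈ s'.hist, e.node = a ∧ e.var = x) ∧
    (∀ e ∈ s'.hist, ∃ (he : e.node < X.π.length) (i j : ℕ), (X.π[e.node]).rule = .resolve i j e.var ∧
      (e.ans, e.coin) = X.answer c e.node e.var (s'.hist.filter fun e' => e.node < e'.node)) ∧
    R ++ (X.query s).toList = s'.hist.filterMap X.coinOf ∧
    ((X.π[s'.cur]).rule = .initial ∨ s'.cur + (n + 1) ≤ X.a₀) := by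
  intro s'
  -- every earlier node is above the current one
  have hpw := dagPath_pairwise_gt hπ.1 h2
  have hvis_gt : ∀ a ∈ s.vis, s.cur < a := fun a ha =>
    (List.pairwise_append.1 hpw).2.2 a ha s.cur (List.mem_singleton_self _)
  have hhist_gt : ∀ e ∈ s.hist, s.cur < e.node := fun e he =>
    hvis_gt _ (h4.subset (List.mem_map.2 ⟨e, he, rfl⟩))
  -- extending the DAG path by a premise of the current node
  have hext : ∀ b ∈ (X.π[s.cur]).premises,
      IsDagPath (X.π.map ResLine.premises) (s.vis ++ [s.cur] ++ [b]) ∧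
      (s.vis ++ [s.cur] ++ [b]).head? = some X.a₀ ∧ b < s.cur := by
    intro b hb
    have hb' := (premise_step hπ.1 h1 hb).1
    refine ⟨⟨?_, ?_⟩, ?_, hb'⟩
    · intro i hi
      rw [List.mem_append] at hi
      rcases hi with hi | hi
      · exact h2.1 i hi
      · rw [List.mem_singleton] at hi; subst hi; rw [List.length_map]; omega
    · refine List.IsChain.append h2.2 (List.isChain_singleton _) fun x hx y hy => ?_
      rw [List.getLast?_concat] at hx
      simp only [Option.mem_def, Option.some.injEq, List.head?_cons] at hx hy
      subst hx; subst hy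
      rw [List.getD_eq_getElem?_getD, List.getElem?_map, List.getElem?_eq_getElem h1]
      simpa using hb
    · rw [List.head?_append, h3]; rfl
  rcases Ctx.mstep_cases c s h1 with ⟨hr, hs', hq⟩ | ⟨i, hr, hs', hq⟩ | ⟨i, j, x, hr, hs', hq⟩
  · -- initial: stay
    have e' : s' = s := hs'
    rw [e', hq]
    exact ⟨h1, h2, h3, h4, h6, h7, by rw [h10]; simp, Or.inl hr⟩
  · -- weakening: pass to the premise
    have e' : s' = ⟨s.vis ++ [s.cur], i, s.hist⟩ := hs'
    have hi : i ∈ (X.π[s.cur]).premises := by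
      unfold ResLine.premises; rw [hr]; simp [ResRule.premises]
    obtain ⟨hpath, hhead, hlt⟩ := hext i hi
    rw [e', hq]
    refine ⟨by show i < X.π.length; omega, hpath, hhead, h4.trans (List.sublist_append_left _ _), ?_, h7,
      by rw [h10]; simp, Or.inr (by show i + (n + 1) ≤ X.a₀; rcases h11 with h | h <;> [exact absurd hr (by rw [h]; simp); omega])⟩
    intro a ha ha' i' j' x' hrule
    rw [List.mem_append] at ha
    rcases ha with ha | ha
    · exact h6 a ha ha' i' j' x' hrule
    · rw [List.mem_singleton] at ha; subst ha; rw [hr] at hrule; cases hrule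
  · -- resolution: answer and record the event
    set ans := (X.answer c s.cur x s.hist).1 with hans
    set coin := (X.answer c s.cur x s.hist).2 with hcoin
    set e : Ev := ⟨s.cur, x, ans, coin⟩ with he
    have e' : s' = ⟨s.vis ++ [s.cur], if ans then j else i, s.hist ++ [e]⟩ := hs'
    have hij : (if ans then j else i) ∈ (X.π[s.cur]).premises := by
      unfold ResLine.premises; rw [hr]; cases ans <;> simp [ResRule.premises]
    obtain ⟨hpath, hhead, hlt⟩ := hext _ hij
    have hfilt : (s.hist ++ [e]).filter (fun e' => s.cur < e'.node) = s.hist := by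
      rw [List.filter_append, List.filter_eq_self.2 (fun e' he' => by simpa using hhist_gt e' he')]
      simp [he]
    rw [e', hq]
    refine ⟨by show (if ans then j else i) < X.π.length; omega, hpath, hhead, ?_, ?_, ?_, ?_,
      Or.inr (by show (if ans then j else i) + (n + 1) ≤ X.a₀; rcases h11 with h | h <;> [exact absurd hr (by rw [h]; simp); omega])⟩
    · rw [List.map_append]; exact h4.append (by simp [he])
    · intro a ha ha' i' j' x' hrule
      rw [List.mem_append] at ha
      rcases ha with ha | ha
      · obtain ⟨e₀, he₀, h₀⟩ := h6 a ha ha' i' j' x' hrule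
        exact ⟨e₀, List.mem_append_left _ he₀, h₀⟩
      · rw [List.mem_singleton] at ha; subst ha
        rw [hr] at hrule; cases hrule
        exact ⟨e, List.mem_append_right _ (List.mem_singleton_self _), rfl, rfl⟩
    · intro e₀ he₀
      rw [List.mem_append] at he₀
      rcases he₀ with he₀ | he₀
      · obtain ⟨hlt₀, i', j', hrule, hansw⟩ := h7 e₀ he₀
        refine ⟨hlt₀, i', j', hrule, ?_⟩
        rw [List.filter_append, hansw]
        congr 1
        have : [e].filter (fun e' => e₀.node < e'.node) = [] := by
          have := hhist_gt e₀ he₀; simp [he]; omega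
        rw [this, List.append_nil]
      · rw [List.mem_singleton] at he₀; subst he₀
        exact ⟨h1, i, j, hr, by rw [hfilt]⟩
    · rw [List.filterMap_append, ← h10]
      congr 1
      simp only [List.filterMap_cons, List.filterMap_nil, Ctx.coinOf, he]
      cases hc : coin
      · have h0 : X.toRead s.cur x s.hist = none := by
          have := Ctx.answer_snd c s.cur x s.hist
          rw [← hcoin, hc] at this
          cases htr : X.toRead s.cur x s.hist with
          | none => rfl
          | some iv => rw [htr] at this; simp at this
        rw [h0]; simp
      · obtain ⟨iv, htr, hd, -, -⟩ := Ctx.answer_of_coin (X := X) (by rw [← hcoin]; exact hc)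
        rw [htr, hd]; simp

/-- STRUCTURAL INVARIANTS of the path process after `n` steps: the current index is a line; the visited
nodes followed by the current one form a DAG path of the refutation from the start node; the event nodes
are, in order, among the visited nodes; every visited resolution node has its event; every event sits at
a resolution line on its variable and records the answer computed from the earlier events; the coins
read by `mrun` are exactly the coin events; and the walk has reached an initial line or descended `n`. -/
theorem Ctx.run_struct (hπ : IsResRefutation X.cnf X.π) (c : Fin X.k × Fin m → Bool) (n : ℕ) :
    ∃ h1 : (X.run c n).cur < X.π.length,
    IsDagPath (X.π.map ResLine.premises) ((X.run c n).vis ++ [(X.run c n).cur]) ∧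
    ((X.run c n).vis ++ [(X.run c n).cur]).head? = some X.a₀ ∧
    ((X.run c n).hist.map Ev.node).Sublist (X.run c n).vis ∧
    (∀ a ∈ (X.run c n).vis, ∀ (ha : a < X.π.length) (i j x : ℕ), (X.π[a]).rule = .resolve i j x →
      ∃ e ∈ (X.run c n).hist, e.node = a ∧ e.var = x) ∧
    (∀ e ∈ (X.run c n).hist, ∃ (he : e.node < X.π.length) (i j : ℕ),
      (X.π[e.node]).rule = .resolve i j e.var ∧
      (e.ans, e.coin) = X.answer c e.node e.var ((X.run c n).hist.filter fun e' => e.node < e'.node)) ∧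
    mreads X.query X.next c X.init n = (X.run c n).hist.filterMap X.coinOf ∧
    ((X.π[(X.run c n).cur]).rule = .initial ∨ (X.run c n).cur + n ≤ X.a₀) := by
  induction n with
  | zero =>
    refine ⟨Ctx.a₀_lt hπ, ⟨?_, List.isChain_singleton _⟩, rfl, List.Sublist.slnil, ?_, ?_, rfl, Or.inr le_rfl⟩
    · intro i hi
      simp only [Ctx.run, mrun, Function.iterate_zero, id_eq, Ctx.init, List.nil_append,
        List.mem_singleton] at hi
      subst hi; rw [List.length_map]; exact Ctx.a₀_lt hπ
    · intro a ha; simp [Ctx.run, mrun, Ctx.init] at ha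
    · intro e he; simp [Ctx.run, mrun, Ctx.init] at he
  | succ n ih =>
    obtain ⟨h1, h2, h3, h4, h6, h7, h10, h11⟩ := ih
    obtain ⟨h1', h2', h3', h4', h6', h7', h10', h11'⟩ := Ctx.struct_step hπ c _ n _ h1 h2 h3 h4 h6 h7 h10 h11
    rw [Ctx.run_succ]
    exact ⟨h1', h2', h3', h4', h6', h7', by rw [mreads_succ]; exact h10', h11'⟩

end Struct

/-- Registered sub-goal `spc_struct_anchor` of stmt-PneNP-9818 (credits this auxiliary file): soundly orderable
sets of size `≤ L₀` keep `δ^{size}·m` common neighbours (closed form of `le_card_commonNbhd_of_soundlyOrderable`). -/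
theorem spc_struct_anchor : ∀ (m : ℕ) (H : SimpleGraph (Fin m)) [DecidableRel H.Adj] (δ : ℝ) (L₀ : ℕ)
    (Q : Finset (Fin m)), 0 ≤ δ → SoundlyOrderable H δ L₀ Q → Q.card ≤ L₀ →
    δ ^ Q.card * (m : ℝ) ≤ ((commonNbhd H Q).card : ℝ) :=
  fun _ _ _ _ _ _ hδ hQ hcard => le_card_commonNbhd_of_soundlyOrderable hδ hQ hcard

end Summit.PneNP.PneNP.Cruxes.RegularResolutionRung.SoundPathBottleneck
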